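import Summits.Ventures.DiscreteObjects.UnitDistance.QuadraticPlanesFourF
import Summits.Ventures.DiscreteObjects.UnitDistance.PlaneSqrt239Four
import Summits.Ventures.DiscreteObjects.UnitDistance.PlaneSqrt47Bounds
import Summits.Ventures.DiscreteObjects.UnitDistance.PlaneUpperBoundSeven
import HarnessLib

/-!
# Quadratic planes with chromatic number four, VII: `χ(ℚ(√287)²) ≤ 4` (a ramified `7`-adic row), `d = 239` exact, and the ledger of open rows below `400`
(cell `pub-namedobj`, target (U), seat udg g16 — summary and one correction)

Framing (verbatim for the cell): lottery ticket; floor = certified bounds/negative ranges.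

No new witness in this file.  Two amendments to the table of `QuadraticPlanesFourF.lean` (udg g15), both already provable from files in the tree:

* `d = 287 = 7 · 41` IS `7`-adic: `−41 ≡ 1 (mod 7)` is a quadratic residue, so `√287 = √(−7) · √(−41) ∈ ℚ₇(√−7)` (the ramified frame `−7` of
  `PadicCriterion.lean`; `PadicPattern 7 {287}` holds by `decide`) and Madore's reduction through `𝔽₇` gives `χ(ℚ(√287)²) ≤ χ(UD(𝔽₇²)) = 4`.  The row
  `287` therefore reads `χ ∈ {3, 4}` (odd cycle; ramified `7`-adic criterion) and joins `239, 263`, not `215, 383` — `FourF` recorded only `χ ≥ 3` for it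
  (`plane_sqrt287_three_four`).
* `d = 239` is EXACT in the kernel since `PlaneSqrt239Four.lean` (udg g15, `W₂₃₉` on `501` vertices, landed after `FourF` was written):
  `χ(ℚ(√239)²) = 4`; the `{239, 263}` clause of `quadratic_table_three_mod_four_200_400` is superseded for `239` (`quadratic_table_three_mod_four_200_400'`).

For the remaining two `d ≡ 7 (mod 8)` rows of that range without a `4`-colouring criterion the upper bound `5` is made explicit: `215 = 5 · 43` is `19`-adic
(`215 ≡ 6 = 5² (mod 19)`), `383` is `11`-adic (`383 ≡ 9 (mod 11)`), so `3 ≤ χ ≤ 5` for both (`plane_sqrt_215_383_three_five`).  Finally the file lists, in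
one statement, every square-free `d ≡ 3 (mod 4)` below `400` whose row is NOT exact, with the interval the tree proves (`quadratic_open_rows_lt_400`):
`{3, 4}` for `83, 107, 155, 203, 227, 251, 263, 287, 299, 323, 347, 371, 395`; `{4, 5}` for `47, 143, 311, 335`; `[3, 5]` for `215, 383`; and `[3, 7]` for
`167` — the only square-free `d ≡ 3 (mod 4)` below `200` to which NO `p`-adic criterion of the tree applies (`167 ≡ 7 (mod 8)`, `≡ 2 (mod 3)`, a non-residue
modulo `7`, `11` and `19`; the bound `7` is Isbell's hexagonal colouring of the whole plane, `PlaneUpperBoundSeven.lean`).  Every other square-free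
`d ≡ 3 (mod 4)` below `400` has `χ(ℚ(√d)²) = 3` (the `d ≢ 2 (mod 3)`) or `= 4` (`11, 23, 35, 59, 71, 95, 119, 131, 179, 191, 239, 359` —
`chromaticNumber_plane_multiSqrtField_eq_four_twelve`).  Values `≥ 4` not found in print (PROVISIONAL).
-/

noncomputable section

namespace Summit.Ventures.DiscreteObjects.UnitDistance

open SimpleGraph IntermediateField
open scoped IntermediateField

/-- CORRECTION OF THE `287` ROW: `ℚ(√287)²` is not `2`-colourable and IS `4`-colourable — `287 = 7 · 41` with `−41 ≡ 1 (mod 7)` a residue, so the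
ramified `7`-adic frame `−7` applies (`PadicPattern 7 {287}` by `decide`).  Hence `χ(ℚ(√287)²) ∈ {3, 4}`. -/
theorem plane_sqrt287_three_four :
    ¬ (planeUnitDistanceGraph.induce (fieldPoints (multiSqrtField {287}))).Colorable 2 ∧
      (planeUnitDistanceGraph.induce (fieldPoints (multiSqrtField {287}))).Colorable 4 :=
  ⟨not_colorable_two_plane_multiSqrtField (Finset.mem_singleton_self _) (by norm_num),
    colorable_four_plane_of_sevenAdic _ (by decide)⟩

/-- The same row in the `ℚ⟮√287⟯` spelling: `3 ≤ χ(ℚ(√287)²) ≤ 4`. -/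
theorem chromaticNumber_plane_sqrt287_bounds :
    3 ≤ (planeUnitDistanceGraph.induce (fieldPoints ℚ⟮Real.sqrt 287⟯)).chromaticNumber ∧
      (planeUnitDistanceGraph.induce (fieldPoints ℚ⟮Real.sqrt 287⟯)).chromaticNumber ≤ 4 := by
  obtain ⟨h2, h4⟩ := plane_sqrt287_three_four
  rw [multiSqrtField_singleton, Nat.cast_ofNat] at h2 h4
  refine ⟨?_, h4.chromaticNumber_le⟩
  by_contra hlt
  have hlt' : (planeUnitDistanceGraph.induce (fieldPoints ℚ⟮Real.sqrt 287⟯)).chromaticNumber < (2 : ℕ∞) + 1 := lt_of_not_ge hlt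
  have hle : (planeUnitDistanceGraph.induce (fieldPoints ℚ⟮Real.sqrt 287⟯)).chromaticNumber ≤ (2 : ℕ) := Order.le_of_lt_add_one hlt'
  exact h2 (chromaticNumber_le_iff_colorable.mp hle)

/-- `215` and `383` (`≡ 7 (mod 8)`, `≡ 2 (mod 3)`, non-residues mod `7`): not `2`-colourable and `5`-colourable — `215 ≡ 5² (mod 19)` is `19`-adic,
`383 ≡ 3² (mod 11)` is `11`-adic.  So `3 ≤ χ(ℚ(√d)²) ≤ 5` for both; no `4`-colouring criterion of the tree applies. -/
theorem plane_sqrt_215_383_three_five :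
    ∀ d ∈ ({215, 383} : Finset ℕ),
      ¬ (planeUnitDistanceGraph.induce (fieldPoints (multiSqrtField {d}))).Colorable 2 ∧
        (planeUnitDistanceGraph.induce (fieldPoints (multiSqrtField {d}))).Colorable 5 := by
  intro d hd
  simp only [Finset.mem_insert, Finset.mem_singleton] at hd
  rcases hd with rfl | rfl
  · exact ⟨not_colorable_two_plane_multiSqrtField (Finset.mem_singleton_self _) (by norm_num),
      colorable_five_plane_of_nineteenAdic _ (by decide)⟩
  · exact ⟨not_colorable_two_plane_multiSqrtField (Finset.mem_singleton_self _) (by norm_num),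
      colorable_five_plane_of_elevenAdic _ (by decide)⟩

/-- The twelve exact rows with value four now in the tree (`11, 23, 35, 59, 71, 95, 119, 131, 179, 191` of udg g12–g14; `239, 359` of udg g15),
atlas vocabulary. -/
theorem chromaticNumber_plane_multiSqrtField_eq_four_twelve :
    ∀ d ∈ ({11, 23, 35, 59, 71, 95, 119, 131, 179, 191, 239, 359} : Finset ℕ),
      (planeUnitDistanceGraph.induce (fieldPoints (multiSqrtField {d}))).chromaticNumber = 4 := by
  intro d hd
  simp only [Finset.mem_insert, Finset.mem_singleton] at hd
  rcases hd with rfl | rfl | rfl | rfl | rfl | rfl | rfl | rfl | rfl | rfl | rfl | rfl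
  · exact chromaticNumber_plane_multiSqrtField_11
  · exact chromaticNumber_plane_multiSqrtField_23
  · exact chromaticNumber_plane_multiSqrtField_35
  · exact chromaticNumber_plane_multiSqrtField_59
  · exact chromaticNumber_plane_multiSqrtField_71
  · exact chromaticNumber_plane_multiSqrtField_95
  · exact chromaticNumber_plane_multiSqrtField_119
  · exact chromaticNumber_plane_multiSqrtField_131
  · exact chromaticNumber_plane_multiSqrtField_179
  · exact chromaticNumber_plane_multiSqrtField_191
  · exact chromaticNumber_plane_multiSqrtField_239
  · exact chromaticNumber_plane_multiSqrtField_359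

/-- THE QUADRATIC TABLE FOR SQUARE-FREE `d ≡ 3 (mod 4)`, `200 < d < 400`, AMENDED (forty values): `= 3` for the twenty-four `d ≢ 2 (mod 3)`;
`= 4` for `239, 359`; `∈ {4, 5}` for `311, 335`; not `2`-colourable and `4`-colourable for `203, 227, 251, 299, 323, 347, 371, 395` (2-adic) and for
`263, 287` (7-adic, `287` through the ramified frame `−7`); not `2`-colourable and `5`-colourable for `215, 383`. -/
theorem quadratic_table_three_mod_four_200_400' :
    (∀ d ∈ ({211, 219, 223, 231, 235, 247, 255, 259, 267, 271, 283, 291, 295, 303, 307, 319, 327, 331, 339, 355, 367, 379, 391, 399} : Finset ℕ),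
        (planeUnitDistanceGraph.induce (fieldPoints (multiSqrtField {d}))).chromaticNumber = 3) ∧
    (∀ d ∈ ({239, 359} : Finset ℕ), (planeUnitDistanceGraph.induce (fieldPoints (multiSqrtField {d}))).chromaticNumber = 4) ∧
    (∀ d ∈ ({311, 335} : Finset ℕ),
        4 ≤ (planeUnitDistanceGraph.induce (fieldPoints (multiSqrtField {d}))).chromaticNumber ∧
          (planeUnitDistanceGraph.induce (fieldPoints (multiSqrtField {d}))).chromaticNumber ≤ 5) ∧
    (∀ d ∈ ({203, 227, 251, 299, 323, 347, 371, 395} : Finset ℕ),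
        ¬ (planeUnitDistanceGraph.induce (fieldPoints ℚ⟮Real.sqrt d⟯)).Colorable 2 ∧
          (planeUnitDistanceGraph.induce (fieldPoints ℚ⟮Real.sqrt d⟯)).Colorable 4) ∧
    (∀ d ∈ ({263, 287} : Finset ℕ),
        ¬ (planeUnitDistanceGraph.induce (fieldPoints (multiSqrtField {d}))).Colorable 2 ∧
          (planeUnitDistanceGraph.induce (fieldPoints (multiSqrtField {d}))).Colorable 4) ∧
    (∀ d ∈ ({215, 383} : Finset ℕ),
        ¬ (planeUnitDistanceGraph.induce (fieldPoints (multiSqrtField {d}))).Colorable 2 ∧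
          (planeUnitDistanceGraph.induce (fieldPoints (multiSqrtField {d}))).Colorable 5) := by
  obtain ⟨h3, -, h45, h2adic, -, -⟩ := quadratic_table_three_mod_four_200_400
  refine ⟨h3, ?_, h45, h2adic, ?_, plane_sqrt_215_383_three_five⟩
  · intro d hd
    simp only [Finset.mem_insert, Finset.mem_singleton] at hd
    rcases hd with rfl | rfl
    · exact chromaticNumber_plane_multiSqrtField_239
    · exact chromaticNumber_plane_multiSqrtField_359
  · intro d hd
    simp only [Finset.mem_insert, Finset.mem_singleton] at hd
    rcases hd with rfl | rfl <;>
      exact ⟨not_colorable_two_plane_multiSqrtField (Finset.mem_singleton_self _) (by norm_num),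
        colorable_four_plane_of_sevenAdic _ (by decide)⟩

/-- Every field plane inherits Isbell's bound: `χ(K²) ≤ χ(ℝ²) ≤ 7`. -/
theorem chromaticNumber_fieldPlane_le_seven (K : IntermediateField ℚ ℝ) :
    (planeUnitDistanceGraph.induce (fieldPoints K)).chromaticNumber ≤ 7 :=
  (plane_colorable_seven.of_hom (Embedding.induce (fieldPoints K)).toHom).chromaticNumber_le

/-- THE OPEN ROWS BELOW `400`.  For square-free `d ≡ 3 (mod 4)`, `d < 400`, the row `χ(ℚ(√d)²)` is exact in the tree (`= 3` or `= 4`) except for these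
twenty values, where the tree proves: `3 ≤ χ ≤ 4` for `83, 107, 155, 203, 227, 251, 263, 287, 299, 323, 347, 371, 395`; `4 ≤ χ ≤ 5` for `47, 143, 311, 335`;
`3 ≤ χ ≤ 5` for `215, 383`; `3 ≤ χ ≤ 7` for `167` (no `p`-adic criterion applies to `167`; `7` is the bound for the whole plane). -/
theorem quadratic_open_rows_lt_400 :
    (∀ d ∈ ({83, 107, 155, 203, 227, 251, 263, 287, 299, 323, 347, 371, 395} : Finset ℕ),
        ¬ (planeUnitDistanceGraph.induce (fieldPoints (multiSqrtField {d}))).Colorable 2 ∧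
          (planeUnitDistanceGraph.induce (fieldPoints (multiSqrtField {d}))).Colorable 4) ∧
    (∀ d ∈ ({47, 143, 311, 335} : Finset ℕ),
        4 ≤ (planeUnitDistanceGraph.induce (fieldPoints (multiSqrtField {d}))).chromaticNumber ∧
          (planeUnitDistanceGraph.induce (fieldPoints (multiSqrtField {d}))).chromaticNumber ≤ 5) ∧
    (∀ d ∈ ({215, 383} : Finset ℕ),
        ¬ (planeUnitDistanceGraph.induce (fieldPoints (multiSqrtField {d}))).Colorable 2 ∧
          (planeUnitDistanceGraph.induce (fieldPoints (multiSqrtField {d}))).Colorable 5) ∧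
    (¬ (planeUnitDistanceGraph.induce (fieldPoints (multiSqrtField {167}))).Colorable 2 ∧
      (planeUnitDistanceGraph.induce (fieldPoints (multiSqrtField {167}))).chromaticNumber ≤ 7) := by
  refine ⟨?_, ?_, plane_sqrt_215_383_three_five, ?_⟩
  · intro d hd
    simp only [Finset.mem_insert, Finset.mem_singleton] at hd
    rcases hd with rfl | rfl | rfl | rfl | rfl | rfl | rfl | rfl | rfl | rfl | rfl | rfl | rfl
    all_goals
      refine ⟨not_colorable_two_plane_multiSqrtField (Finset.mem_singleton_self _) (by norm_num), ?_⟩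
    -- 2-adic rows (`d ≡ 3 (mod 8)`): 83, 107, 155, 203, 227, 251, 299, 323, 347, 371, 395; 7-adic rows: 263, 287
    · exact (multiSqrtField_singleton (d := 83) ▸ (plane_sqrt_three_four_of_mod_eight 83 (by norm_num)).2)
    · exact (multiSqrtField_singleton (d := 107) ▸ (plane_sqrt_three_four_of_mod_eight 107 (by norm_num)).2)
    · exact (multiSqrtField_singleton (d := 155) ▸ (plane_sqrt_three_four_of_mod_eight 155 (by norm_num)).2)
    · exact (multiSqrtField_singleton (d := 203) ▸ (plane_sqrt_three_four_of_mod_eight 203 (by norm_num)).2)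
    · exact (multiSqrtField_singleton (d := 227) ▸ (plane_sqrt_three_four_of_mod_eight 227 (by norm_num)).2)
    · exact (multiSqrtField_singleton (d := 251) ▸ (plane_sqrt_three_four_of_mod_eight 251 (by norm_num)).2)
    · exact colorable_four_plane_of_sevenAdic _ (by decide)
    · exact colorable_four_plane_of_sevenAdic _ (by decide)
    · exact (multiSqrtField_singleton (d := 299) ▸ (plane_sqrt_three_four_of_mod_eight 299 (by norm_num)).2)
    · exact (multiSqrtField_singleton (d := 323) ▸ (plane_sqrt_three_four_of_mod_eight 323 (by norm_num)).2)
    · exact (multiSqrtField_singleton (d := 347) ▸ (plane_sqrt_three_four_of_mod_eight 347 (by norm_num)).2)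
    · exact (multiSqrtField_singleton (d := 371) ▸ (plane_sqrt_three_four_of_mod_eight 371 (by norm_num)).2)
    · exact (multiSqrtField_singleton (d := 395) ▸ (plane_sqrt_three_four_of_mod_eight 395 (by norm_num)).2)
  · intro d hd
    simp only [Finset.mem_insert, Finset.mem_singleton] at hd
    rcases hd with rfl | rfl | rfl | rfl
    · exact chromaticNumber_plane_multiSqrtField_47_bounds
    · exact chromaticNumber_plane_multiSqrtField_143_bounds
    · exact chromaticNumber_plane_multiSqrtField_311_bounds
    · exact chromaticNumber_plane_multiSqrtField_335_bounds
  · exact ⟨not_colorable_two_plane_multiSqrtField (Finset.mem_singleton_self _) (by norm_num), chromaticNumber_fieldPlane_le_seven _⟩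

end Summit.Ventures.DiscreteObjects.UnitDistance
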